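import Summits.HubbardSuperconductivity.HubbardSuperconductivity.Theorems.AposterioriCapRgSsbToEvenTorusLroPairTransferRung
import Summits.HubbardSuperconductivity.HubbardSuperconductivity.Theorems.WcbcsSsbToTorusLRO.Negative.SummitMatrixUniformFloor
import Summits.HubbardSuperconductivity.HubbardSuperconductivity.Theorems.BalabanIRBirEveryGroundStateAffine
import Summits.HubbardSuperconductivity.HubbardSuperconductivity.Theorems.TwTipContinuation.Negative.TipNormalForm

/-!
# Crux `JmPairBridge` (stmt-HubbardSuperconductivity-2226), line `Sketch` — the gap-free half (windowed bridge)

Route `JosephsonMirror`, crux `JmPairBridge` (thesis X: the every-ground-state pair bridge between the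
`(N_L, S^z = 0)` and `(N_L − 2, S^z = 0)` ground floors of `hubbardTorus 2 L 1 U`, `N_L = 2⌊(1-δ)L²/2⌋`,
`Δ_d = pairField dWaveFormFactor L`). Helper file of line `Sketch` (card `pair-sum-rule-concentration`)
isolating WHERE the sector-gap hypothesis of the line enters: without any gap, the uniform LRO floor
`a L⁴ ≤ ‖Δ_d φ‖²` and the charge-gap convexity floor `e(N_L+2) + e(N_L−2) − 2e(N_L) ≥ −C/L²` already give

* `firstMoment_pairField_le` — the ONE-SIDED first-moment budget: for every unit ground state `φ` of
  `(N_L, 0)` (large even `L`), `x := Re⟨Δ_dφ, H Δ_dφ⟩ − e(N_L − 2)‖Δ_dφ‖² ≤ C'' L²` (the two-sided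
  Koma–Tasaki transfer inequality `Theorems.stub_pairTransferRung`, the variational principle
  `y ≥ 0` in `(N_L + 2, 0)`, the a-priori bound `‖Δ_dφ‖² ≤ C_d L⁴` and the convexity floor);
* `windowedBridge_of_lroFloor_of_convexity` — the WINDOWED bridge for EVERY ground state: the unit vector
  `χ = Δ_dφ/‖Δ_dφ‖` of the sector `(N_L − 2, 0)` has energy `≤ e(N_L − 2) + Γ/L²` (`Γ = C''/a`) and
  `|⟨χ, Δ_dφ⟩|² = ‖Δ_dφ‖² ≥ a L⁴`.

So pair LRO puts the whole pair amplitude `Δ_dφ` within `O(L⁻²)` (in Rayleigh quotient) of the `(N_L − 2)`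
floor; the crux asks for the EXACT floor, and the only extra input the line uses for that is the sector gap
(`stub_pairBridgeAt_of_floors`). This is the "energy-window bridge" restatement named in the route's kill
criterion (a) for `JmInterchange`, here obtained from LRO + convexity alone.

Sources: T. Koma, H. Tasaki, J. Stat. Phys. 76 (1994) 745, Thm 2.2 and §3.4 (the low-lying states forced
by LRO live in `N ± 2`); H. Tasaki, H. Watanabe (2021), arXiv:2105.10692 (charge gap vs ODLRO);
H. Tasaki, J. Stat. Phys. 174 (2019) 735, §3. No definition, no named fact.
-/

noncomputable section

-- the mandated namespace `Summit.<Summit>.<Problem>.Theorems` repeats `HubbardSuperconductivity`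
-- (single-problem summit, D-0017), which the `dupNamespace` linter flags on every declaration
set_option linter.dupNamespace false

namespace Summit.HubbardSuperconductivity.HubbardSuperconductivity.Theorems.JosephsonMirror

open Matrix Literature.MathematicalPhysics.QuantumLattice Literature.Probability.LatticeModels
open Summit.HubbardSuperconductivity.TwTipContinuation.Negative (expect_pairIntensity_le)
open scoped ComplexOrder

/-- **One-sided first-moment budget of the pair field.** For real `U` and `0 < δ < 1/2`, given the
charge-gap convexity floor `e(N_L+2) + e(N_L−2) − 2e(N_L) ≥ −C/L²` (eventually in even `L`), there are
`C'' ≥ 0` and `L₀` such that for every even `L ≥ L₀`, `L ≠ 0`, and every unit ground state `φ` of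
`hubbardTorus 2 L 1 U` in `(N_L, S^z = 0)`: `Δ_dφ ∈ szSector (N_L − 2) 0` and
`Re⟨Δ_dφ, H Δ_dφ⟩ − e(N_L − 2) ‖Δ_dφ‖² ≤ C'' L²`. From the two-sided transfer inequality
`Theorems.stub_pairTransferRung` (`x + y ≤ C_R L² + max(0, −Δ_c)‖Δ_dφ‖²`), `y ≥ 0` (variational principle in
`(N_L + 2, 0)`), `‖Δ_dφ‖² ≤ C_d L⁴` and the convexity floor. Koma–Tasaki (1994) Thm 2.2;
Tasaki–Watanabe (2021). [folklore] -/
theorem firstMoment_pairField_le (U δ : ℝ) (hδ : δ ∈ Set.Ioo (0 : ℝ) (1 / 2))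
    (hConv : ∃ C : ℝ, ∃ L₀ : ℕ, ∀ (L : ℕ), Even L → L₀ ≤ L →
      -C / (L : ℝ) ^ 2 ≤
        (hubbardTorus 2 L 1 U).minEnergyOn
            (szSector (Λ := FermionTorus 2 L) (2 * ⌊(1 - δ) * (L : ℝ) ^ 2 / 2⌋₊ + 2) 0) +
          (hubbardTorus 2 L 1 U).minEnergyOn
            (szSector (Λ := FermionTorus 2 L) (2 * ⌊(1 - δ) * (L : ℝ) ^ 2 / 2⌋₊ - 2) 0) -
          2 * (hubbardTorus 2 L 1 U).minEnergyOn
            (szSector (Λ := FermionTorus 2 L) (2 * ⌊(1 - δ) * (L : ℝ) ^ 2 / 2⌋₊) 0)) :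
    ∃ C'' : ℝ, 0 ≤ C'' ∧ ∃ L₀ : ℕ, ∀ (L : ℕ) [NeZero L], Even L → L₀ ≤ L →
      ∀ φ : Fock (Orb (FermionTorus 2 L)),
        IsGroundStateInSector (hubbardTorus 2 L 1 U) (2 * ⌊(1 - δ) * (L : ℝ) ^ 2 / 2⌋₊) 0 φ →
          star φ ⬝ᵥ φ = 1 →
            pairField dWaveFormFactor L *ᵥ φ ∈
                szSector (Λ := FermionTorus 2 L) (2 * ⌊(1 - δ) * (L : ℝ) ^ 2 / 2⌋₊ - 2) 0 ∧
              (star (pairField dWaveFormFactor L *ᵥ φ) ⬝ᵥ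
                    hubbardTorus 2 L 1 U *ᵥ (pairField dWaveFormFactor L *ᵥ φ)).re -
                  (hubbardTorus 2 L 1 U).minEnergyOn
                      (szSector (Λ := FermionTorus 2 L) (2 * ⌊(1 - δ) * (L : ℝ) ^ 2 / 2⌋₊ - 2) 0) *
                    (star (pairField dWaveFormFactor L *ᵥ φ) ⬝ᵥ (pairField dWaveFormFactor L *ᵥ φ)).re ≤
                C'' * (L : ℝ) ^ 2 := by
  classical
  obtain ⟨hδ0, hδ1⟩ := hδ
  obtain ⟨C₁, L₂, hconv⟩ := hConv
  have haw : 0 < (1 - δ) / 2 := by linarith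
  obtain ⟨CR, hR⟩ := Theorems.stub_pairTransferRung U ((1 - δ) / 2) haw
  set Cd : ℝ := (∑ e ∈ insert 0 unitSteps, ‖((dWaveFormFactor e / Real.sqrt 2 : ℝ) : ℂ)‖ * 2) ^ 2 with hCd
  have hCd0 : 0 ≤ Cd := by positivity
  refine ⟨max CR 0 + max C₁ 0 * Cd, by positivity, max L₂ 4, fun L _ hL hL₀ φ hφ hφ1 => ?_⟩
  have hL₂ : L₂ ≤ L := (le_max_left _ _).trans hL₀
  have hL4 : 4 ≤ L := (le_max_right _ _).trans hL₀
  have hLr : (4 : ℝ) ≤ (L : ℝ) := by exact_mod_cast hL4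
  have hL2pos : (0 : ℝ) < (L : ℝ) ^ 2 := by positivity
  have hL16 : (16 : ℝ) ≤ (L : ℝ) ^ 2 := by nlinarith
  set y : ℝ := (1 - δ) * (L : ℝ) ^ 2 / 2 with hy
  have hy0 : 0 ≤ y := by rw [hy]; exact div_nonneg (mul_nonneg (by linarith) hL2pos.le) (by norm_num)
  set n₀ : ℕ := ⌊(1 - δ) * (L : ℝ) ^ 2 / 2⌋₊ with hn₀
  have hn₀le : (n₀ : ℝ) ≤ y := Nat.floor_le hy0
  have hn₀gt : y < (n₀ : ℝ) + 1 := Nat.lt_floor_add_one y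
  have hy4 : (4 : ℝ) < y := by rw [hy]; nlinarith
  have hn₀1 : 1 ≤ n₀ := by
    have : (3 : ℝ) < (n₀ : ℝ) := by linarith
    exact_mod_cast (show (1 : ℝ) ≤ n₀ by linarith)
  set N : ℕ := 2 * n₀ with hN
  set m : ℕ := N - 2 with hm
  have hNm : m + 2 = N := by omega
  have hm4 : m + 4 = N + 2 := by omega
  have hmr : (m : ℝ) = 2 * (n₀ : ℝ) - 2 := by
    have : ((m + 2 : ℕ) : ℝ) = ((2 * n₀ : ℕ) : ℝ) := by rw [hNm]
    push_cast at this
    linarith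
  have hw1 : (1 - δ) / 2 * (L : ℝ) ^ 2 ≤ (m : ℝ) := by rw [hmr]; nlinarith
  have hw2 : (m : ℝ) + 4 ≤ (2 - (1 - δ) / 2) * (L : ℝ) ^ 2 := by rw [hmr]; nlinarith
  set H := hubbardTorus 2 L 1 U with hH
  set P := pairField dWaveFormFactor L with hP
  have hφ' : IsGroundStateInSector H (m + 2) 0 φ := by rw [hNm]; exact hφ
  obtain ⟨hvK, hwK, hxy, -, -, -⟩ := hR L m φ hw1 hw2 hφ' hφ1
  set v := P *ᵥ φ with hv
  have hGram : star φ ⬝ᵥ ((Pᴴ * P) *ᵥ φ) = star v ⬝ᵥ v := by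
    rw [hv, Literature.MathematicalPhysics.QuantumLattice.star_mulVec_dotProduct_mulVec]
  have hGram' : star φ ⬝ᵥ ((P * Pᴴ) *ᵥ φ) = star (Pᴴ *ᵥ φ) ⬝ᵥ (Pᴴ *ᵥ φ) := by
    rw [Literature.MathematicalPhysics.QuantumLattice.star_mulVec_dotProduct_mulVec,
      conjTranspose_conjTranspose]
  have hS0 : 0 ≤ (star v ⬝ᵥ v).re := EigenvalueContinuation.re_star_dotProduct_self_nonneg v
  have hSle : (star v ⬝ᵥ v).re ≤ Cd * (L : ℝ) ^ 4 := by
    have h := expect_pairIntensity_le L φ hφ1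
    simp only [expect] at h
    rw [hGram] at h
    simpa [hCd] using h
  have hy' : 0 ≤ (star (Pᴴ *ᵥ φ) ⬝ᵥ H *ᵥ (Pᴴ *ᵥ φ)).re -
      H.minEnergyOn (szSector (Λ := FermionTorus 2 L) (m + 4) 0) * (star (Pᴴ *ᵥ φ) ⬝ᵥ (Pᴴ *ᵥ φ)).re := by
    have := minEnergyOn_mul_re_le H (szSector (Λ := FermionTorus 2 L) (m + 4) 0) hwK
    linarith
  have hconvL : 2 * H.minEnergyOn (szSector (Λ := FermionTorus 2 L) (m + 2) 0) -
      H.minEnergyOn (szSector (Λ := FermionTorus 2 L) m 0) -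
      H.minEnergyOn (szSector (Λ := FermionTorus 2 L) (m + 4) 0) ≤ max C₁ 0 / (L : ℝ) ^ 2 := by
    have h := hconv L hL hL₂
    rw [hm4, hNm]
    have h1 : -C₁ / (L : ℝ) ^ 2 ≥ -(max C₁ 0 / (L : ℝ) ^ 2) := by
      rw [neg_div, ge_iff_le, neg_le_neg_iff]
      exact div_le_div_of_nonneg_right (le_max_left _ _) hL2pos.le
    have h2 : H.minEnergyOn (szSector (Λ := FermionTorus 2 L) (N - 2) 0) =
        H.minEnergyOn (szSector (Λ := FermionTorus 2 L) m 0) := by rw [hm]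
    rw [h2] at h
    linarith
  have hmax : max 0 (2 * H.minEnergyOn (szSector (Λ := FermionTorus 2 L) (m + 2) 0) -
      H.minEnergyOn (szSector (Λ := FermionTorus 2 L) m 0) -
      H.minEnergyOn (szSector (Λ := FermionTorus 2 L) (m + 4) 0)) ≤ max C₁ 0 / (L : ℝ) ^ 2 :=
    max_le (div_nonneg (le_max_right _ _) hL2pos.le) hconvL
  refine ⟨hvK, ?_⟩
  simp only [expect] at hxy
  rw [hGram, hGram'] at hxy
  have hprod : max 0 (2 * H.minEnergyOn (szSector (Λ := FermionTorus 2 L) (m + 2) 0) -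
      H.minEnergyOn (szSector (Λ := FermionTorus 2 L) m 0) -
      H.minEnergyOn (szSector (Λ := FermionTorus 2 L) (m + 4) 0)) * (star v ⬝ᵥ v).re ≤
      max C₁ 0 / (L : ℝ) ^ 2 * (Cd * (L : ℝ) ^ 4) :=
    mul_le_mul hmax hSle hS0 (div_nonneg (le_max_right _ _) hL2pos.le)
  have hsimp : max C₁ 0 / (L : ℝ) ^ 2 * (Cd * (L : ℝ) ^ 4) = max C₁ 0 * Cd * (L : ℝ) ^ 2 := by
    field_simp
  rw [hsimp] at hprod
  have hCR : CR * (L : ℝ) ^ 2 ≤ max CR 0 * (L : ℝ) ^ 2 :=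
    mul_le_mul_of_nonneg_right (le_max_left _ _) hL2pos.le
  have : (max CR 0 + max C₁ 0 * Cd) * (L : ℝ) ^ 2 =
      max CR 0 * (L : ℝ) ^ 2 + max C₁ 0 * Cd * (L : ℝ) ^ 2 := by ring
  rw [this]
  linarith

/-- **The windowed pair bridge for EVERY ground state, gap-free.** For real `U` and `0 < δ < 1/2`: the
uniform LRO floor `a L⁴ ≤ ‖Δ_dφ‖²` and the charge-gap convexity floor give `Γ` and `L₀` such that for every
even `L ≥ L₀`, `L ≠ 0`, and every unit ground state `φ` of `(N_L, S^z = 0)`, the unit vector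
`χ = Δ_dφ/‖Δ_dφ‖ ∈ szSector (N_L − 2) 0` has energy `Re⟨χ, Hχ⟩ ≤ e(N_L − 2) + Γ/L²` and
`a L⁴ ≤ |⟨χ, Δ_dφ⟩|²` (`= ‖Δ_dφ‖²`). That is: pair LRO places the whole pair amplitude within `O(L⁻²)` of the
`(N_L − 2)` ground floor in Rayleigh quotient; the exact-floor bridge (the crux) needs in addition only the
sector gap (`stub_pairBridgeAt_of_floors`). Koma–Tasaki (1994) §3.4; Tasaki (2019) §3. [folklore] -/
theorem windowedBridge_of_lroFloor_of_convexity (U δ : ℝ) (hδ : δ ∈ Set.Ioo (0 : ℝ) (1 / 2))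
    (hLRO : ∃ a : ℝ, 0 < a ∧ ∃ L₀ : ℕ, ∀ (L : ℕ) [NeZero L], Even L → L₀ ≤ L →
      ∀ φ : Fock (Orb (FermionTorus 2 L)),
        IsGroundStateInSector (hubbardTorus 2 L 1 U) (2 * ⌊(1 - δ) * (L : ℝ) ^ 2 / 2⌋₊) 0 φ →
          star φ ⬝ᵥ φ = 1 →
            a * (L : ℝ) ^ 4 ≤
              (star (pairField dWaveFormFactor L *ᵥ φ) ⬝ᵥ (pairField dWaveFormFactor L *ᵥ φ)).re)
    (hConv : ∃ C : ℝ, ∃ L₀ : ℕ, ∀ (L : ℕ), Even L → L₀ ≤ L →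
      -C / (L : ℝ) ^ 2 ≤
        (hubbardTorus 2 L 1 U).minEnergyOn
            (szSector (Λ := FermionTorus 2 L) (2 * ⌊(1 - δ) * (L : ℝ) ^ 2 / 2⌋₊ + 2) 0) +
          (hubbardTorus 2 L 1 U).minEnergyOn
            (szSector (Λ := FermionTorus 2 L) (2 * ⌊(1 - δ) * (L : ℝ) ^ 2 / 2⌋₊ - 2) 0) -
          2 * (hubbardTorus 2 L 1 U).minEnergyOn
            (szSector (Λ := FermionTorus 2 L) (2 * ⌊(1 - δ) * (L : ℝ) ^ 2 / 2⌋₊) 0)) :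
    ∃ a : ℝ, 0 < a ∧ ∃ Γ : ℝ, ∃ L₀ : ℕ, ∀ (L : ℕ) [NeZero L], Even L → L₀ ≤ L →
      ∀ φ : Fock (Orb (FermionTorus 2 L)),
        IsGroundStateInSector (hubbardTorus 2 L 1 U) (2 * ⌊(1 - δ) * (L : ℝ) ^ 2 / 2⌋₊) 0 φ →
          star φ ⬝ᵥ φ = 1 →
            ∃ χ : Fock (Orb (FermionTorus 2 L)),
              χ ∈ szSector (Λ := FermionTorus 2 L) (2 * ⌊(1 - δ) * (L : ℝ) ^ 2 / 2⌋₊ - 2) 0 ∧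
                star χ ⬝ᵥ χ = 1 ∧
                  (star χ ⬝ᵥ hubbardTorus 2 L 1 U *ᵥ χ).re ≤
                      (hubbardTorus 2 L 1 U).minEnergyOn
                          (szSector (Λ := FermionTorus 2 L) (2 * ⌊(1 - δ) * (L : ℝ) ^ 2 / 2⌋₊ - 2) 0) +
                        Γ / (L : ℝ) ^ 2 ∧
                    a * (L : ℝ) ^ 4 ≤ ‖star χ ⬝ᵥ Matrix.mulVec (pairField dWaveFormFactor L) φ‖ ^ 2 := by
  classical
  obtain ⟨a, ha, L₁, hlro⟩ := hLRO
  obtain ⟨C'', hC''0, L₂, hfm⟩ := firstMoment_pairField_le U δ hδ hConv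
  refine ⟨a, ha, C'' / a, max L₁ L₂, fun L _ hL hL₀ φ hφ hφ1 => ?_⟩
  have hL₁ : L₁ ≤ L := (le_max_left _ _).trans hL₀
  have hL₂ : L₂ ≤ L := (le_max_right _ _).trans hL₀
  have hLpos : (0 : ℝ) < (L : ℝ) := by exact_mod_cast Nat.pos_of_ne_zero (NeZero.ne L)
  have hL2pos : (0 : ℝ) < (L : ℝ) ^ 2 := by positivity
  set H := hubbardTorus 2 L 1 U with hH
  set P := pairField dWaveFormFactor L with hP
  set v := P *ᵥ φ with hv
  set K := szSector (Λ := FermionTorus 2 L) (2 * ⌊(1 - δ) * (L : ℝ) ^ 2 / 2⌋₊ - 2) 0 with hK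
  obtain ⟨hvK, hx⟩ := hfm L hL hL₂ φ hφ hφ1
  have hS : a * (L : ℝ) ^ 4 ≤ (star v ⬝ᵥ v).re := hlro L hL hL₁ φ hφ hφ1
  have hSpos : 0 < (star v ⬝ᵥ v).re := lt_of_lt_of_le (by positivity) hS
  have hv0 : v ≠ 0 := by
    intro h0
    rw [h0, dotProduct_zero, Complex.zero_re] at hSpos
    exact lt_irrefl _ hSpos
  -- normalise `v`
  obtain ⟨c, hc0, hcc, hunit⟩ := EigenvalueContinuation.exists_normalize hv0
  refine ⟨(c : ℂ) • v, K.smul_mem _ hvK, hunit, ?_, ?_⟩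
  · -- energy of the normalised pair amplitude
    have hE : (star ((c : ℂ) • v) ⬝ᵥ H *ᵥ ((c : ℂ) • v)).re = c * c * (star v ⬝ᵥ H *ᵥ v).re := by
      rw [mulVec_smul, EigenvalueContinuation.star_real_smul_dotProduct_real_smul, Complex.re_ofReal_mul]
    have hN : c * c * (star v ⬝ᵥ v).re = 1 := by
      have h := congrArg Complex.re hunit
      rw [EigenvalueContinuation.star_real_smul_dotProduct_real_smul, Complex.re_ofReal_mul,
        Complex.one_re] at h
      exact h
    rw [hE]
    -- `c² Re⟨v,Hv⟩ ≤ e + (C''/a)/L²` from `Re⟨v,Hv⟩ ≤ e‖v‖² + C'' L²`, `c²‖v‖² = 1`, `‖v‖² ≥ a L⁴`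
    have hcc0 : 0 ≤ c * c := mul_self_nonneg c
    have h1 : c * c * (star v ⬝ᵥ H *ᵥ v).re ≤
        c * c * (H.minEnergyOn K * (star v ⬝ᵥ v).re + C'' * (L : ℝ) ^ 2) :=
      mul_le_mul_of_nonneg_left (by linarith) hcc0
    have h2 : c * c * (H.minEnergyOn K * (star v ⬝ᵥ v).re + C'' * (L : ℝ) ^ 2) =
        H.minEnergyOn K + c * c * (C'' * (L : ℝ) ^ 2) := by
      have : c * c * (H.minEnergyOn K * (star v ⬝ᵥ v).re) = H.minEnergyOn K * (c * c * (star v ⬝ᵥ v).re) := by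
        ring
      rw [mul_add, this, hN, mul_one]
    have h3 : c * c * (C'' * (L : ℝ) ^ 2) ≤ C'' / a / (L : ℝ) ^ 2 := by
      -- `c² = 1/‖v‖² ≤ 1/(a L⁴)`
      have hcc_le : c * c ≤ 1 / (a * (L : ℝ) ^ 4) := by
        rw [le_div_iff₀ (by positivity), ← hN]
        exact mul_le_mul_of_nonneg_left hS hcc0
      calc c * c * (C'' * (L : ℝ) ^ 2) ≤ 1 / (a * (L : ℝ) ^ 4) * (C'' * (L : ℝ) ^ 2) :=
            mul_le_mul_of_nonneg_right hcc_le (by positivity)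
        _ = C'' / a / (L : ℝ) ^ 2 := by
            field_simp
    linarith
  · -- the overlap: `⟨c v, v⟩ = c ‖v‖²`, `|c ‖v‖²|² = c²‖v‖⁴ = ‖v‖²`
    have hov : star ((c : ℂ) • v) ⬝ᵥ Matrix.mulVec P φ = (c : ℂ) * (star v ⬝ᵥ v) := by
      rw [← hv, star_smul, smul_dotProduct, Complex.star_def, Complex.conj_ofReal, smul_eq_mul]
    have hvv : star v ⬝ᵥ v = ((star v ⬝ᵥ v).re : ℂ) := by
      rw [Complex.ext_iff]
      exact ⟨by simp, by simp [EigenvalueContinuation.im_star_dotProduct_self]⟩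
    rw [hov, hvv, ← Complex.ofReal_mul, Complex.norm_real, Real.norm_eq_abs, sq_abs]
    have hN : c * c * (star v ⬝ᵥ v).re = 1 := by
      have h := congrArg Complex.re hunit
      rw [EigenvalueContinuation.star_real_smul_dotProduct_real_smul, Complex.re_ofReal_mul,
        Complex.one_re] at h
      exact h
    have : (c * (star v ⬝ᵥ v).re) ^ 2 = (star v ⬝ᵥ v).re := by
      calc (c * (star v ⬝ᵥ v).re) ^ 2 = (c * c * (star v ⬝ᵥ v).re) * (star v ⬝ᵥ v).re := by ring
        _ = (star v ⬝ᵥ v).re := by rw [hN, one_mul]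
    rw [this]
    exact hS

end Summit.HubbardSuperconductivity.HubbardSuperconductivity.Theorems.JosephsonMirror

end
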